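import Mathlib
import HarnessLib
import Summits.HubbardSuperconductivity.HubbardSuperconductivity.Theorems.KLProgrammeKLRegimeEngineV8E5LevelCounts
import Literature.MathematicalPhysics.QuantumLattice.SectorisedKernelNorm
import Literature.MathematicalPhysics.QuantumLattice.GrassmannKernelExpansion
import Literature.MathematicalPhysics.QuantumLattice.GrassmannTruncatedSpectators

/-!
# Route `KLProgramme` — ENGINE child gen 8 (stmt-HubbardSuperconductivity-20437 `KLRegimeEngineV17F2`), SKELETON v2 class #3, PROVING side:
# the VERTEX PACKAGE of the E.5 witness from ONE levelled-norm LAW of the carrier (the `∃ (C,u)` ASSEMBLY, part 5a; RIDER (A) currency, default reading)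
# (cell gate-hubbard-kl, seat p5 g9; sequel to `…E5WitnessStep(L1)`; memo HOME/prover-p5/E5-GAIN-SCALE-N.md §12, §18 r18a)

The witness `exists_e5Pkg2_of_stepData(L1)` reads the (R1′) carrier `W_Λ` through its level norms at the two value-form prescription patterns
(`Nf k q`: «`k` contracted legs free, `q` outputs prescribed», `Ne k q`: «three explicit contracted sectors, `q` outputs prescribed»), ONE envelope
`∀ q ∈ Icc 1 4, (κ₀²+κ₁²)^{k−3}·(ε·Nf k q)·(ε·Ne k (4−q)) ≤ x′^{k−3}·A` with `x′ ≤ ½`, and the size `A ≤ CA·ε²·(Klam U)³·8^n`.  This file shows that ALL of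
that follows from ONE law in the shape of the class-#1 MIXED rows (`LevelsUMixedAt`, BGM 2006 Lemma 2.5 (2.98)) for a generic Grassmann element `W` and a
generic family `F` at «level `j = n−2`»:

  `‖W‖_{F, prescribedTuples univ Ωe} ≤ C₀·Θ^{m/2}·g^{m/2−1}·2^{(3m/2−5)j}·(2^{−j})^{levelGainExp (levelCount Ωe)}`   (every EVEN `m ≥ 4`, every prescription `Ωe`),

odd-leg prescriptions `≤ 0` (an even element), with the gain factor on EVERY degree INCLUDING THE QUARTIC (r18a: `LevelsUMixedAt`'s gain-free quartic
clause is short by `2^j` on class (8,4) at `k = 4` and cannot be re-routed), `g = Klam·U`-type coupling, `Θ ≥ 1` the table's geometric growth (`c_p ≤ C₀Θ^p`):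

* `hubbardSectorKernelNorm_eq_zero_of_evenOdd_zero_of_not_even` — the odd clause for an even element (what a supplier uses to discharge `hWodd`);
* **`klE5_vertexPackage_of_levelLaw`** — under that law and the single smallness `(κ₀² + κ₁²)·Θ·g·8^{n−2} ≤ ½`:
  `∃ Nf Ne x′ A`, with `Nf k q := law(k+q, q)`, `Ne k q := law(k+q, 3+q)` (`0` at odd `k+q`), `x′ := (κ₀²+κ₁²)·Θ·g·8^{n−2}`,
  `A := ε²·C₀²·Θ⁵·g³·8^{n−2}`, satisfying EXACTLY the vertex conjuncts of `e5ShareStep2_of_stepData`'s `h3` (`hNe0`, `hNf`, `hNe`, `0 ≤ x′ ≤ ½`, `0 ≤ A`, the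
  envelope) and `A ≤ (C₀²Θ⁵/64)·ε²·g³·8^n`.  The count: per colouring class the two level gains add to `≥ 2` (`two_le_levelGainExp_add`), so
  `(ε·Nf k q)·(ε·Ne k (4−q)) ≤ ε²·C₀²·Θ^{k+2}·g^k·2^{(3k−6)j} = A·(Θ·g·8^j)^{k−3}`.

(The sequel `…E5WitnessLevelsLaw` plugs this into `exists_e5Pkg2_of_stepDataL1`.)

Pure real bookkeeping (`levelCount_append_none_some`, `levelCount_append_dite_some`, `two_le_levelGainExp_add`); no definitions, no named facts, nothing
about the model's sizes is asserted (the law is a hypothesis); nothing asserts superconductivity.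
-/

noncomputable section

namespace Summit.HubbardSuperconductivity.HubbardSuperconductivity.Theorems.KLRegimeSplit

set_option linter.dupNamespace false -- summit = problem name (single-conjunct summit), D-0017

open Real Finset Literature.MathematicalPhysics.QuantumLattice Literature.Probability.LatticeModels GrassmannAlgebra Matrix

/-! ## §7 One levelled-norm law ⇒ the vertex package (`Nf`, `Ne`, `x′`, `A`, the envelope) -/

section LevelLaw

variable {L M N : ℕ} [NeZero L] (β : ℝ) (F : Fin N → FreqMomentum L M → ℂ) (W : HubbardGrassmann L M)


/-- **Odd-degree prescriptions of an EVEN element vanish**: `W ∈ evenOdd 0`, `m` odd ⇒ `‖W‖_{F, A} = 0` for every tuple set `A` of `m`-tuples (the law's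
odd clause `hWodd` for a supplier who knows the carrier is even). [folklore] -/
theorem hubbardSectorKernelNorm_eq_zero_of_evenOdd_zero_of_not_even {W : HubbardGrassmann L M} (hW : W ∈ evenOdd ℂ 0) {m : ℕ} (hm : ¬ Even m)
    (A : Finset (Fin m → SectorLeg N)) : hubbardSectorKernelNorm L M β F A W = 0 := by
  have hk : sectorisedKernel L M β F W m = 0 := by
    funext Ω x
    simp only [sectorisedKernel, kernel_eq_zero_of_mem_evenPart_of_odd ℂ (mem_evenPart_iff.2 hW) (Nat.not_even_iff_odd.1 hm), mul_zero,
      Finset.sum_const_zero, Pi.zero_apply]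
  rw [hubbardSectorKernelNorm, hk]
  exact sectorisedKernelNorm_zero_kernel _ _ _

/-- **The vertex package of the E.5 witness from ONE levelled-norm law** (shape of `LevelsUMixedAt` WITH the gain on every degree, odd prescriptions `0`,
table growth `Θ ≥ 1`, coupling `g ≥ 0`, level `n−2`) and the single smallness `κs·Θ·g·8^{n−2} ≤ ½` (`κs` = the envelope's Gram base, e.g. `κ₀² + κ₁²`): the functions `Nf`, `Ne`, the ratio `x′` and the
size `A` of `e5ShareStep2_of_stepData`'s hypothesis, with its envelope and `A ≤ (C₀²Θ⁵/64)·ε²·g³·8^n`. [cite: BenfattoGiulianiMastropietro2006, Lemma 2.5 (2.98)] -/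
theorem klE5_vertexPackage_of_levelLaw {n : ℕ} (hn : 2 ≤ n) {g C₀ Θ : ℝ} (hg : 0 ≤ g) (hC₀ : 0 ≤ C₀) (hΘ : 1 ≤ Θ) {κs : ℝ} (hκs : 0 ≤ κs)
    (hW : ∀ m : ℕ, 4 ≤ m → Even m → ∀ Ωe : Fin m → Option (SectorLeg N),
      hubbardSectorKernelNorm L M β F (prescribedTuples univ Ωe) W ≤
        C₀ * Θ ^ (m / 2) * g ^ (m / 2 - 1) * (2 : ℝ) ^ ((3 * (m / 2) - 5) * (n - 2)) * (((2 : ℝ) ^ (n - 2))⁻¹) ^ levelGainExp (levelCount Ωe))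
    (hWodd : ∀ m : ℕ, ¬ Even m → ∀ Ωe : Fin m → Option (SectorLeg N), hubbardSectorKernelNorm L M β F (prescribedTuples univ Ωe) W ≤ 0)
    (hsmall : κs * Θ * g * (8 : ℝ) ^ (n - 2) ≤ 1 / 2) :
    ∃ (Nf Ne : ℕ → ℕ → ℝ) (x' A : ℝ), (∀ k q, 0 ≤ Ne k q) ∧
      (∀ k ∈ Icc 3 (Fintype.card (HubbardFieldIdx L M × Fin 2) + 2), ∀ q ≤ 4, ∀ σ : Fin q → SectorLeg N,
        hubbardSectorKernelNorm L M β F (prescribedTuples univ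
          (Fin.append (fun _ : Fin k => (none : Option (SectorLeg N))) (fun j => some (σ j)))) W ≤ Nf k q) ∧
      (∀ k ∈ Icc 3 (Fintype.card (HubbardFieldIdx L M × Fin 2) + 2), ∀ q ≤ 4, ∀ (τ : Fin 3 → SectorLeg N) (σ : Fin q → SectorLeg N),
        hubbardSectorKernelNorm L M β F (prescribedTuples univ
          (Fin.append (fun i : Fin k => if h : (i : ℕ) < 3 then some (τ ⟨i, h⟩) else none) (fun j => some (σ j)))) W ≤ Ne k q) ∧
      0 ≤ x' ∧ x' ≤ 1 / 2 ∧ 0 ≤ A ∧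
      (∀ q ∈ Icc 1 4, ∀ k ∈ Icc 3 (Fintype.card (HubbardFieldIdx L M × Fin 2) + 2),
        κs ^ (k - 3) * ((imagTimeWeight β M * Nf k q) * (imagTimeWeight β M * Ne k (4 - q))) ≤ x' ^ (k - 3) * A) ∧
      A ≤ (C₀ ^ 2 * Θ ^ 5 / 64) * imagTimeWeight β M ^ 2 * g ^ 3 * (8 : ℝ) ^ n := by
  classical
  obtain ⟨j, rfl⟩ : ∃ j, n = j + 2 := ⟨n - 2, by omega⟩
  simp only [Nat.add_sub_cancel] at hW hsmall
  have hΘ0 : 0 ≤ Θ := zero_le_one.trans hΘ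
  have h2j : (0 : ℝ) < (2 : ℝ) ^ j := by positivity
  have hr0 : 0 ≤ ((2 : ℝ) ^ j)⁻¹ := by positivity
  have hr1 : ((2 : ℝ) ^ j)⁻¹ ≤ 1 := inv_le_one_of_one_le₀ (one_le_pow₀ (by norm_num))
  have hε : 0 ≤ imagTimeWeight β M ^ 2 := sq_nonneg _
  -- the law as numbers
  refine ⟨fun k q => if Even (k + q) then C₀ * Θ ^ ((k + q) / 2) * g ^ ((k + q) / 2 - 1) * (2 : ℝ) ^ ((3 * ((k + q) / 2) - 5) * j) *
      (((2 : ℝ) ^ j)⁻¹) ^ levelGainExp q else 0,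
    fun k q => if Even (k + q) then C₀ * Θ ^ ((k + q) / 2) * g ^ ((k + q) / 2 - 1) * (2 : ℝ) ^ ((3 * ((k + q) / 2) - 5) * j) *
      (((2 : ℝ) ^ j)⁻¹) ^ levelGainExp (3 + q) else 0,
    κs * Θ * g * (8 : ℝ) ^ j, imagTimeWeight β M ^ 2 * (C₀ ^ 2 * Θ ^ 5 * g ^ 3 * (8 : ℝ) ^ j),
    ?_, ?_, ?_, by positivity, hsmall, by positivity, ?_, ?_⟩
  · -- `0 ≤ Ne`
    intro k q
    dsimp only
    split_ifs
    · positivity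
    · exact le_rfl
  · -- `hNf`: «k free, q outputs prescribed» has level `q`
    intro k hk q _ σ
    dsimp only
    have hk3 : 3 ≤ k := (mem_Icc.1 hk).1
    by_cases he : Even (k + q)
    · rw [if_pos he]
      have h4 : 4 ≤ k + q := by obtain ⟨t, ht⟩ := he; omega
      have h := hW (k + q) h4 he (Fin.append (fun _ : Fin k => (none : Option (SectorLeg N))) (fun i => some (σ i)))
      rwa [levelCount_append_none_some] at h
    · rw [if_neg he]
      exact hWodd (k + q) he _
  · -- `hNe`: «three explicit contracted sectors, q outputs prescribed» has level `3 + q`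
    intro k hk q _ τ σ
    dsimp only
    have hk3 : 3 ≤ k := (mem_Icc.1 hk).1
    by_cases he : Even (k + q)
    · rw [if_pos he]
      have h4 : 4 ≤ k + q := by obtain ⟨t, ht⟩ := he; omega
      have h := hW (k + q) h4 he (Fin.append (fun i : Fin k => if h : (i : ℕ) < 3 then some (τ ⟨i, h⟩) else none) (fun i => some (σ i)))
      rwa [levelCount_append_dite_some hk3] at h
    · rw [if_neg he]
      exact hWodd (k + q) he _
  · -- the envelope: the two gains add to `≥ 2`
    intro q hq k hk
    dsimp only
    obtain ⟨hq1, hq4⟩ := mem_Icc.1 hq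
    have hk3 : 3 ≤ k := (mem_Icc.1 hk).1
    obtain ⟨k', rfl⟩ : ∃ k', k = k' + 3 := ⟨k - 3, by omega⟩
    rw [show k' + 3 - 3 = k' from by omega]
    by_cases he : Even (k' + 3 + q)
    · have he' : Even (k' + 3 + (4 - q)) := by
        obtain ⟨t, ht⟩ := he
        exact ⟨t + 2 - q, by omega⟩
      rw [if_pos he, if_pos he']
      -- the two half-degrees
      obtain ⟨p₁, hp₁⟩ : ∃ p₁, (k' + 3 + q) / 2 = p₁ := ⟨_, rfl⟩
      obtain ⟨p₂, hp₂⟩ : ∃ p₂, (k' + 3 + (4 - q)) / 2 = p₂ := ⟨_, rfl⟩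
      have hsum : p₁ + p₂ = k' + 5 := by
        obtain ⟨t, ht⟩ := he
        obtain ⟨t', ht'⟩ := he'
        omega
      have hp₁2 : 2 ≤ p₁ := by omega
      have hp₂2 : 2 ≤ p₂ := by omega
      rw [hp₁, hp₂]
      -- collect the powers
      have hΘpow : Θ ^ p₁ * Θ ^ p₂ = Θ ^ k' * Θ ^ 5 := by rw [← pow_add, hsum, pow_add]
      have hgpow : g ^ (p₁ - 1) * g ^ (p₂ - 1) = g ^ k' * g ^ 3 := by
        rw [← pow_add, ← pow_add]; congr 1; omega
      have h2pow : (2 : ℝ) ^ ((3 * p₁ - 5) * j) * (2 : ℝ) ^ ((3 * p₂ - 5) * j) = (2 : ℝ) ^ ((3 * k' + 5) * j) := by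
        rw [← pow_add, ← add_mul]; congr 2; omega
      have hG : 2 ≤ levelGainExp q + levelGainExp (3 + (4 - q)) := two_le_levelGainExp_add (by omega)
      have hrG : (((2 : ℝ) ^ j)⁻¹) ^ levelGainExp q * (((2 : ℝ) ^ j)⁻¹) ^ levelGainExp (3 + (4 - q)) ≤ (((2 : ℝ) ^ j)⁻¹) ^ 2 := by
        rw [← pow_add]; exact pow_le_pow_of_le_one hr0 hr1 hG
      have hkey : (2 : ℝ) ^ ((3 * k' + 5) * j) * (((2 : ℝ) ^ j)⁻¹) ^ 2 = ((8 : ℝ) ^ j) ^ k' * (8 : ℝ) ^ j := by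
        have e : (2 : ℝ) ^ ((3 * k' + 5) * j) = ((8 : ℝ) ^ j) ^ k' * (8 : ℝ) ^ j * ((2 : ℝ) ^ j) ^ 2 := by
          rw [show (8 : ℝ) = 2 ^ 3 by norm_num, ← pow_mul, ← pow_mul, ← pow_mul, ← pow_mul, ← pow_add, ← pow_add]
          congr 1; ring
        rw [e, inv_pow, mul_assoc, mul_inv_cancel₀ (pow_ne_zero _ h2j.ne'), mul_one]
      -- the base without gains
      set B : ℝ := κs ^ k' * imagTimeWeight β M ^ 2 * C₀ ^ 2 * (Θ ^ k' * Θ ^ 5) * (g ^ k' * g ^ 3) *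
        (2 : ℝ) ^ ((3 * k' + 5) * j) with hB
      have hB0 : 0 ≤ B := by positivity
      calc κs ^ k' *
            (imagTimeWeight β M * (C₀ * Θ ^ p₁ * g ^ (p₁ - 1) * (2 : ℝ) ^ ((3 * p₁ - 5) * j) * (((2 : ℝ) ^ j)⁻¹) ^ levelGainExp q) *
              (imagTimeWeight β M * (C₀ * Θ ^ p₂ * g ^ (p₂ - 1) * (2 : ℝ) ^ ((3 * p₂ - 5) * j) * (((2 : ℝ) ^ j)⁻¹) ^ levelGainExp (3 + (4 - q)))))
          = κs ^ k' * imagTimeWeight β M ^ 2 * C₀ ^ 2 * (Θ ^ p₁ * Θ ^ p₂) * (g ^ (p₁ - 1) * g ^ (p₂ - 1)) *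
              ((2 : ℝ) ^ ((3 * p₁ - 5) * j) * (2 : ℝ) ^ ((3 * p₂ - 5) * j)) *
              ((((2 : ℝ) ^ j)⁻¹) ^ levelGainExp q * (((2 : ℝ) ^ j)⁻¹) ^ levelGainExp (3 + (4 - q))) := by ring
        _ = B * ((((2 : ℝ) ^ j)⁻¹) ^ levelGainExp q * (((2 : ℝ) ^ j)⁻¹) ^ levelGainExp (3 + (4 - q))) := by
            rw [hΘpow, hgpow, h2pow]
        _ ≤ B * (((2 : ℝ) ^ j)⁻¹) ^ 2 := mul_le_mul_of_nonneg_left hrG hB0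
        _ = (κs * Θ * g * (8 : ℝ) ^ j) ^ k' * (imagTimeWeight β M ^ 2 * (C₀ ^ 2 * Θ ^ 5 * g ^ 3 * (8 : ℝ) ^ j)) := by
            rw [hB, mul_pow, mul_pow, mul_pow]
            calc κs ^ k' * imagTimeWeight β M ^ 2 * C₀ ^ 2 * (Θ ^ k' * Θ ^ 5) * (g ^ k' * g ^ 3) *
                  (2 : ℝ) ^ ((3 * k' + 5) * j) * (((2 : ℝ) ^ j)⁻¹) ^ 2
                = κs ^ k' * imagTimeWeight β M ^ 2 * C₀ ^ 2 * (Θ ^ k' * Θ ^ 5) * (g ^ k' * g ^ 3) *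
                  ((2 : ℝ) ^ ((3 * k' + 5) * j) * (((2 : ℝ) ^ j)⁻¹) ^ 2) := by ring
              _ = κs ^ k' * imagTimeWeight β M ^ 2 * C₀ ^ 2 * (Θ ^ k' * Θ ^ 5) * (g ^ k' * g ^ 3) *
                  (((8 : ℝ) ^ j) ^ k' * (8 : ℝ) ^ j) := by rw [hkey]
              _ = _ := by ring
    · -- odd total degree on copy `0`: the kernel vanishes, the summand is `0`
      rw [if_neg he, mul_zero, zero_mul, mul_zero]
      positivity
  · -- `A ≤ (C₀²Θ⁵/64)·ε²·g³·8^n`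
    rw [pow_add]
    refine le_of_eq ?_
    ring

end LevelLaw

end Summit.HubbardSuperconductivity.HubbardSuperconductivity.Theorems.KLRegimeSplit

end
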